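import Literature.Probability.Percolation.SlabCircuitNeedle
import HarnessLib

/-!
# Newman–Tassion–Wu 2017, Theorem 3.8 / CPAM Theorem 3.10 — the VERTICAL SURGERY of the circuit gluing
# lemma: the minimal circuit is unchanged, the source is glued, the column is recovered

Topic: `Literature/Probability/Percolation`.  Third file of the circuit gluing layer (data:
`SlabCircuitGlueData.lean`; needle combinatorics: `SlabCircuitNeedle.lean`).  For `D : CircGlue k`, a
lattice configuration `ω ∈ 𝒳` (`D.evX`: the source reaches a column of `Γ = Γ_min` inside the world
but not `Γ` itself) and an entry cell `y ∈ U(ω)` (`D.Uent ω`: `y` a column of `Γ`, a lattice pair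
`{u, v}` with `v` over `y`, `u` off the columns of `Γ` and joined to the source off those columns),
NTW's configuration `ω^{(z)}` is built by ONE COLUMN of surgery: with `g` the vertex of `Γ` over `y`
nearest to `v`, close every pair at the vertices of the vertical segment `[v, g)` and open the pairs of
the needle `u, v, …, g` ("Close all the edges in `B₁(z)` except those in `Γ₁(ω)` and `κ_z` … open all
the vertical edges between `u` and `v`", CPAM p. 15).  We prove:

* `CircGlue.vNdl`, `.vInner`, `.vConfig` — the needle, its inner vertices, the new configuration;
  `vConfig_agree` (the modification is confined to the column), `vConfig_window`, `vConfig_needle`.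
* `CircGlue.Γ_vConfig` — **`Γ(ω^{(z)}) = Γ(ω)`** ("the local modification does not create any new
  circuit": by `needle_circuit` a new surrounding circuit would give an old open path `u ⟷ g`, gluing
  the source to `Γ` — excluded on `𝒳`).
* `CircGlue.joined_vConfig` — the source is joined to `g ∈ Γ` by a path meeting `Γ` only at `g`.
* `CircGlue.att_vConfig_subset` — **recovery**: the statistic `att(ω^{(z)})` lies over `y` ("`u` is the
  only site on `Γ₁(ω^{(z)})` that connects to `Γ₂` without using any other edges in `Γ₁`").
* `CircGlue.exists_vGadget` — **a located gadget (`VGadget`) at every entry cell of every lattice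
  configuration of `𝒳`**, for ANY finite world: no routing lemma and no condition on the shape of the
  domains (contrast with the path gluing of `SlabRSWGluing*`).

## Sources

* C. M. Newman, V. Tassion, W. Wu, *Critical percolation and the minimal spanning tree in slabs*,
  Comm. Pure Appl. Math. 70 (2017) 2084–2120 = arXiv:1512.09107: §3.2, proof of Theorem 3.8 (arXiv)
  = Theorem 3.10 (CPAM), (3.5)–(3.8), pp. 14–16 [NewmanTassionWu2017].
-/

noncomputable section

namespace Literature.Probability.Percolation

open MeasureTheory LatticeModels SimpleGraph

namespace NTW17

/-! ## The vertical surgery -/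

namespace CircGlue

section VSurgery

variable {k : ℕ}

/-- **The needle** of the vertical surgery at the cell `y`: the far vertex `u` followed by the vertical
segment of the column over `y` from `v` to the vertex `g` of `Γ`.
[cite: NewmanTassionWu2017, §3.2 (CPAM Theorem 3.10: κ_z ∋ v, the vertical segment between u and v)] -/
def vNdl (u v g : slab 3 k) (y : ℤ × ℤ) : List (slab 3 k) := u :: vline k y (ht v) (ht g)

/-- The inner vertices of the needle: the vertical segment without `g`. [cite: NewmanTassionWu2017, §3.2 (CPAM Theorem 3.10)] -/
def vInner (v g : slab 3 k) (y : ℤ × ℤ) : Set (slab 3 k) := {x | x ∈ vline k y (ht v) (ht g) ∧ x ≠ g}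

/-- **The new configuration `ω^{(z)}`**: close every pair at an inner vertex of the needle, then open
the pairs of consecutive needle vertices. [cite: NewmanTassionWu2017, §3.2 (CPAM Theorem 3.10: "Close all the edges in B₁(z) except those in Γ₁(ω) and κ_z … open all the vertical edges between u and v")] -/
def vConfig (ω : BondConfig (slab 3 k)) (u v g : slab 3 k) (y : ℤ × ℤ) : BondConfig (slab 3 k) :=
  (ω \ {e | ∃ x, x ∈ e ∧ x ∈ vInner v g y}) ∪ edgesOf (vNdl u v g y)

variable {u v g : slab 3 k} {y : ℤ × ℤ} {ω : BondConfig (slab 3 k)}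

/-- The vertical segment is a self-avoiding lattice path from `v` to `g`. [cite: NewmanTassionWu2017, §3.2 (CPAM Theorem 3.10, the vertical segment between u and v)] -/
theorem vSeg_spath (hvy : planar k v = y) (hgy : planar k g = y) :
    SPath (vline k y (ht v) (ht g)) v g := by
  have h := vline_spath (k := k) y (ht_le v) (ht_le g)
  rwa [← hvy, vtx_planar_ht, hvy, ← hgy, vtx_planar_ht, hgy] at h

/-- Membership in the vertical segment. [cite: NewmanTassionWu2017, §3.2 (CPAM Theorem 3.10, the vertical segment between u and v)] -/
theorem mem_vSeg_iff (x : slab 3 k) :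
    x ∈ vline k y (ht v) (ht g) ↔ planar k x = y ∧ min (ht v) (ht g) ≤ ht x ∧ ht x ≤ max (ht v) (ht g) :=
  mem_vline_iff (ht_le v) (ht_le g) x

/-- `v` is the first vertex of the segment. [cite: NewmanTassionWu2017, §3.2 (CPAM Theorem 3.10, the vertical segment between u and v)] -/
theorem v_mem_vSeg (hvy : planar k v = y) : v ∈ vline k y (ht v) (ht g) :=
  (mem_vSeg_iff v).2 ⟨hvy, min_le_left _ _, le_max_left _ _⟩

/-- `g` is the last vertex of the segment. [cite: NewmanTassionWu2017, §3.2 (CPAM Theorem 3.10, the vertical segment between u and v)] -/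
theorem g_mem_vSeg (hgy : planar k g = y) : g ∈ vline k y (ht v) (ht g) :=
  (mem_vSeg_iff g).2 ⟨hgy, min_le_right _ _, le_max_right _ _⟩

/-- `u` (off the column) is not on the segment. [cite: NewmanTassionWu2017, §3.2 (CPAM Theorem 3.10, the vertical segment between u and v)] -/
theorem u_not_mem_vSeg (huy : planar k u ≠ y) : u ∉ vline k y (ht v) (ht g) :=
  fun h => huy ((mem_vSeg_iff u).1 h).1

/-- The needle has no duplicates. [cite: NewmanTassionWu2017, §3.2 (CPAM Theorem 3.10, the vertical segment between u and v)] -/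
theorem vNdl_nodup (hvy : planar k v = y) (hgy : planar k g = y) (huy : planar k u ≠ y) :
    (vNdl u v g y).Nodup :=
  List.nodup_cons.2 ⟨u_not_mem_vSeg huy, (vSeg_spath hvy hgy).nodup⟩

/-- The needle is a lattice chain. [cite: NewmanTassionWu2017, §3.2 (CPAM Theorem 3.10, the vertical segment between u and v)] -/
theorem vNdl_chain (hvy : planar k v = y) (hgy : planar k g = y) (huv : (slabGraph 3 k).Adj u v) :
    (vNdl u v g y).IsChain (fun a b => (slabGraph 3 k).Adj a b) := by
  unfold vNdl
  rw [List.isChain_cons]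
  refine ⟨fun x hx => ?_, (vSeg_spath hvy hgy).chain⟩
  rw [(vSeg_spath hvy hgy).head, Option.mem_def, Option.some.injEq] at hx
  subst hx; exact huv

/-- The head of the needle is `u`, its last vertex is `g`. [cite: NewmanTassionWu2017, §3.2 (CPAM Theorem 3.10, the vertical segment between u and v)] -/
theorem vNdl_head_last (hvy : planar k v = y) (hgy : planar k g = y) :
    (vNdl u v g y).head (List.cons_ne_nil _ _) = u ∧ (vNdl u v g y).getLast (List.cons_ne_nil _ _) = g := by
  refine ⟨rfl, ?_⟩
  have hsp := vSeg_spath (k := k) (v := v) (g := g) hvy hgy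
  have h1 : (vNdl u v g y).getLast (List.cons_ne_nil _ _) = (vline k y (ht v) (ht g)).getLast hsp.ne_nil := by
    unfold vNdl; rw [List.getLast_cons hsp.ne_nil]
  rw [h1]
  exact Option.some.inj ((List.getLast?_eq_some_getLast hsp.ne_nil).symm.trans hsp.last)

/-- The needle is `u` followed by `v`. [cite: NewmanTassionWu2017, §3.2 (CPAM Theorem 3.10, the vertical segment between u and v)] -/
theorem vNdl_eq_cons_cons (hvy : planar k v = y) (hgy : planar k g = y) :
    ∃ N₂, vNdl u v g y = u :: v :: N₂ ∧ vline k y (ht v) (ht g) = v :: N₂ := by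
  have hsp := vSeg_spath (k := k) (v := v) (g := g) hvy hgy
  obtain ⟨w, N₂, hw⟩ := List.exists_cons_of_ne_nil hsp.ne_nil
  have hv : w = v := by
    have := hsp.head
    rw [hw] at this; simpa using this
  rw [hv] at hw
  exact ⟨N₂, by unfold vNdl; rw [hw], hw⟩

/-- Membership in the new configuration. [cite: NewmanTassionWu2017, §3.2 (CPAM Theorem 3.10, ω^{(z)})] -/
theorem mem_vConfig_iff {e : Sym2 (slab 3 k)} :
    e ∈ vConfig ω u v g y ↔ (e ∈ ω ∧ ∀ x ∈ e, x ∉ vInner v g y) ∨ e ∈ edgesOf (vNdl u v g y) := by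
  simp only [vConfig, Set.mem_union, Set.mem_sdiff, Set.mem_setOf_eq, not_exists, not_and]

/-- Old pairs of the new configuration: a pair of `ω^{(z)}` which is not a needle pair is `ω`-open.
[cite: NewmanTassionWu2017, §3.2 (CPAM Theorem 3.10)] -/
theorem mem_of_mem_vConfig {e : Sym2 (slab 3 k)} (he : e ∈ vConfig ω u v g y)
    (hne : e ∉ edgesOf (vNdl u v g y)) : e ∈ ω := by
  rcases mem_vConfig_iff.1 he with h | h
  · exact h.1
  · exact absurd h hne

/-- In a list without duplicates, the second vertex of a consecutive pair is not the head. [folklore] -/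
private theorem ne_head_of_split {α : Type*} {L l₁ l₂ : List α} {a b : α} (hnd : L.Nodup)
    (h : L = l₁ ++ a :: b :: l₂) : b ≠ L.head (by rw [h]; simp) := by
  intro hb
  have hne : l₁ ++ [a] ≠ [] := by simp
  have h' : L = (l₁ ++ [a]) ++ b :: l₂ := by rw [h]; simp
  have hhead : L.head (by rw [h]; simp) = (l₁ ++ [a]).head hne := by
    simp only [h', List.head_append_of_ne_nil hne]
  rw [h', List.nodup_append] at hnd
  exact hnd.2.2 _ (hb ▸ hhead ▸ List.head_mem hne) b List.mem_cons_self rfl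

/-- The second vertex of a needle pair lies on the vertical segment. [cite: NewmanTassionWu2017, §3.2 (CPAM Theorem 3.10, the vertical segment between u and v)] -/
theorem mem_vSeg_of_split (hvy : planar k v = y) (hgy : planar k g = y) (huy : planar k u ≠ y)
    {l₁ l₂ : List (slab 3 k)} {a b : slab 3 k} (hl : vNdl u v g y = l₁ ++ a :: b :: l₂) :
    b ∈ vline k y (ht v) (ht g) := by
  have hb : b ∈ vNdl u v g y := by rw [hl]; simp
  rw [vNdl, List.mem_cons] at hb
  rcases hb with hb | hb
  · exact absurd hb (ne_head_of_split (vNdl_nodup hvy hgy huy) hl)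
  · exact hb

/-- Every needle pair touches the column over `y`. [cite: NewmanTassionWu2017, §3.2 (CPAM Theorem 3.10, the vertical segment between u and v)] -/
theorem touch_of_mem_edgesOf_vNdl (hvy : planar k v = y) (hgy : planar k g = y) (huy : planar k u ≠ y)
    {e : Sym2 (slab 3 k)} (he : e ∈ edgesOf (vNdl u v g y)) : e ∈ touch k ({y} : Set (ℤ × ℤ)) := by
  obtain ⟨a, b, l₁, l₂, hl, rfl⟩ := he
  rw [mk_mem_touch_iff]
  exact Or.inr (((mem_vSeg_iff b).1 (mem_vSeg_of_split hvy hgy huy hl)).1)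

/-- **The modification is confined to the column over `y`.** [cite: NewmanTassionWu2017, §3.2 (CPAM Theorem 3.10: the modification acts in B₁(z))] -/
theorem vConfig_agree (hvy : planar k v = y) (hgy : planar k g = y) (huy : planar k u ≠ y)
    {e : Sym2 (slab 3 k)} (he : e ∉ touch k ({y} : Set (ℤ × ℤ))) : e ∈ ω ↔ e ∈ vConfig ω u v g y := by
  rw [mem_vConfig_iff]
  have hne : e ∉ edgesOf (vNdl u v g y) := fun h => he (touch_of_mem_edgesOf_vNdl hvy hgy huy h)
  have hin : ∀ x ∈ e, x ∉ vInner v g y := by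
    intro x hx hxI
    exact he ⟨x, hx, by rw [Set.mem_singleton_iff]; exact ((mem_vSeg_iff x).1 hxI.1).1⟩
  constructor
  · exact fun h => Or.inl ⟨h, hin⟩
  · rintro (h | h)
    · exact h.1
    · exact absurd h hne

/-- **The window**: the new configuration consists of old pairs and lattice pairs over the world, as soon
as `u` and the column over `y` lie over the world. [cite: NewmanTassionWu2017, §3.2 (CPAM Theorem 3.10)] -/
theorem vConfig_window (hvy : planar k v = y) (hgy : planar k g = y) (huv : (slabGraph 3 k).Adj u v)
    {W : Set (ℤ × ℤ)} (huW : planar k u ∈ W) (hyW : y ∈ W) {e : Sym2 (slab 3 k)}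
    (he : e ∈ vConfig ω u v g y) : e ∈ ω ∨ (e ∈ (slabGraph 3 k).edgeSet ∧ e ∈ (slabLift k W).sym2) := by
  rcases mem_vConfig_iff.1 he with h | h
  · exact Or.inl h.1
  · right
    refine ⟨edgesOf_subset_edgeSet (vNdl_chain hvy hgy huv) h, ?_⟩
    obtain ⟨a, b, l₁, l₂, hl, rfl⟩ := h
    have hmem : ∀ x ∈ vNdl u v g y, x ∈ slabLift k W := by
      intro x hx
      rw [vNdl, List.mem_cons] at hx
      rw [mem_slabLift_iff]
      rcases hx with rfl | hx
      · exact huW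
      · rw [((mem_vSeg_iff x).1 hx).1]; exact hyW
    rw [Set.mk_mem_sym2_iff]
    exact ⟨hmem a (by rw [hl]; simp), hmem b (by rw [hl]; simp)⟩

/-- **The needle property of `ω^{(z)}`**: an open pair of the new configuration at an inner vertex of the
needle joins it to one of its two needle neighbours. [cite: NewmanTassionWu2017, §3.2 (CPAM Theorem 3.10: all other edges at the segment are closed)] -/
theorem vConfig_needle (hvy : planar k v = y) (hgy : planar k g = y) (huy : planar k u ≠ y) :
    ∀ (x z : slab 3 k) (m₁ m₂ : List (slab 3 k)), vNdl u v g y = m₁ ++ x :: m₂ → m₁ ≠ [] → m₂ ≠ [] →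
      s(x, z) ∈ vConfig ω u v g y →
      (∃ l₁ l₂, vNdl u v g y = l₁ ++ x :: z :: l₂) ∨ (∃ l₁ l₂, vNdl u v g y = l₁ ++ z :: x :: l₂) := by
  intro x z m₁ m₂ hl hm₁ hm₂ hxz
  have hnd := vNdl_nodup hvy hgy huy
  -- `x` is an inner vertex
  have hxI : x ∈ vInner v g y := by
    obtain ⟨c, m₁', rfl⟩ := List.exists_cons_of_ne_nil hm₁
    have hx : x ∈ vline k y (ht v) (ht g) := by
      have : x ∈ vNdl u v g y := by rw [hl]; simp
      rw [vNdl, List.mem_cons] at this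
      rcases this with rfl | h
      · -- `x = u` is the head, but occurs after `c`
        exfalso
        have hc : x = c := by have := congrArg List.head? hl; simpa [vNdl] using this
        subst hc
        rw [hl, List.cons_append, List.nodup_cons] at hnd
        exact hnd.1 (by simp)
      · exact h
    refine ⟨hx, fun hxg => ?_⟩
    -- `x = g` is the last vertex of the needle, but `m₂ ≠ []` follows it
    have hlast := (vNdl_head_last (u := u) hvy hgy).2
    rw [List.getLast_congr _ (by rw [← hl]; exact List.cons_ne_nil _ _) hl,
      List.getLast_append_of_ne_nil _ (List.cons_ne_nil _ _), List.getLast_cons hm₂] at hlast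
    rw [hl, List.nodup_append] at hnd
    exact (List.nodup_cons.1 hnd.2.1).1 (hxg ▸ hlast ▸ List.getLast_mem hm₂)
  -- so the pair is a needle pair
  have hE : s(x, z) ∈ edgesOf (vNdl u v g y) := by
    rcases mem_vConfig_iff.1 hxz with h | h
    · exact absurd hxI (h.2 x (Sym2.mem_mk_left _ _))
    · exact h
  rcases next_of_mem_edgesOf hnd hl hE with ⟨r', hr'⟩ | ⟨l₁', hl₁'⟩
  · exact Or.inl ⟨m₁, r', by rw [hl, hr']⟩
  · exact Or.inr ⟨l₁', m₂, by rw [hl, hl₁']; simp⟩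

end VSurgery

end CircGlue
/-! ## The vertical surgery preserves the minimal circuit, glues the source, and is recoverable -/

namespace CircGlue

section Main

variable {k : ℕ} {D : CircGlue k} {ω : BondConfig (slab 3 k)} {y : ℤ × ℤ} {u v g : slab 3 k}

/-- `u`, off the columns of `Γ`, is not over `y = planar g`. [folklore] -/
private theorem huy_of (hg : g ∈ D.Γ ω) (hgy : planar k g = y) (hufar : ¬Near k (D.Γ ω) 0 (planar k u)) :
    planar k u ≠ y := fun h => hufar (near_zero_iff.2 ⟨g, hg, by rw [hgy, h]⟩)

/-- Vertices of the segment other than `g` are off `Γ` (when `g` is the nearest vertex of `Γ` in the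
column). [folklore] -/
private theorem not_mem_Γ_of_inner (hinner : ∀ x ∈ vline k y (ht v) (ht g), x ∈ D.Γ ω → x = g)
    {x : slab 3 k} (hx : x ∈ vInner v g y) : x ∉ D.Γ ω := fun h => hx.2 (hinner x hx.1 h)

/-- A far vertex is not on `Γ` and not on the segment. [folklore] -/
private theorem far_props (hg : g ∈ D.Γ ω) (hgy : planar k g = y) {x : slab 3 k}
    (hx : ¬Near k (D.Γ ω) 0 (planar k x)) : x ∉ D.Γ ω ∧ x ∉ vline k y (ht v) (ht g) := by
  refine ⟨fun h => hx (near_zero_iff.2 ⟨x, h, rfl⟩), fun h => hx (near_zero_iff.2 ⟨g, hg, ?_⟩)⟩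
  rw [hgy, ((mem_vSeg_iff x).1 h).1]

/-- **`u` is not joined to `Γ` inside the world** on `𝒳` (else the source would be).
[cite: NewmanTassionWu2017, §3.2 (CPAM Theorem 3.10, Γ₁ ↮ Γ₂ on the event)] -/
theorem not_joined_u (hX : ω ∈ D.evX) (hjf : D.JoinedFar ω u) {g' : slab 3 k} (hg' : g' ∈ D.Γ ω) :
    ω ∉ openConnIn (slabLift k D.W) u g' := by
  intro h
  obtain ⟨c₀, hc₀, hfar⟩ := hjf
  have h1 : ω ∈ openConnIn (slabLift k D.W) c₀ u := openConnIn_mono Set.inter_subset_left _ _ hfar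
  exact not_joined_of_evX hX hc₀ hg' (SlabCriticality.openConnIn_trans h1 h)

/-- **The minimal circuit is unchanged by the vertical surgery** (`Γ(ω^{(z)}) = Γ(ω)`): `Γ` stays open
(no pair at an inner vertex of the needle is a pair of `Γ`), and a surrounding circuit of the new
configuration using a new pair would contain the whole needle (`needle_circuit`) and exhibit an old
open path from `u` to `g ∈ Γ` — impossible on `𝒳`.
[cite: NewmanTassionWu2017, §3.2 (CPAM Theorem 3.10: "the local modification above does not create any new circuit in A_{m,n}")] -/
theorem Γ_vConfig (hX : ω ∈ D.evX) (hvy : planar k v = y) (hgy : planar k g = y) (hg : g ∈ D.Γ ω)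
    (hufar : ¬Near k (D.Γ ω) 0 (planar k u)) (hjf : D.JoinedFar ω u)
    (hinner : ∀ x ∈ vline k y (ht v) (ht g), x ∈ D.Γ ω → x = g) :
    D.Γ (vConfig ω u v g y) = D.Γ ω := by
  have huy := huy_of hg hgy hufar
  have hH : ω ∈ D.evH := evH_of_evX hX
  obtain ⟨⟨hΓc, hΓs⟩, hΓmin⟩ := Γ_spec hH
  set ω' := vConfig ω u v g y with hω'
  have hnd := vNdl_nodup hvy hgy huy
  -- `Γ` is an open circuit of `ω'`
  have hΓc' : IsOpenCircuit k ω' (slabLift k (annulus D.c D.m D.n)) (D.Γ ω) := by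
    refine hΓc.of_edges fun a ha b hb hab => mem_vConfig_iff.2 (Or.inl ⟨hab, fun x hx hxI => ?_⟩)
    rcases Sym2.mem_iff.1 hx with rfl | rfl
    · exact not_mem_Γ_of_inner hinner hxI ha
    · exact not_mem_Γ_of_inner hinner hxI hb
  -- minimality
  refine minCircuit_eq_of_min hΓc' hΓs fun l hl hs => ?_
  by_cases hall : (∀ (a b : slab 3 k) (l₁ l₂ : List (slab 3 k)), l = l₁ ++ a :: b :: l₂ → s(a, b) ∈ ω) ∧
      (∀ hne : l ≠ [], s(l.getLast hne, l.head hne) ∈ ω)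
  · exact hΓmin l (hl.of_consecutive hall.1 hall.2) hs
  · exfalso
    have h3 := IsOpenCircuit.three_le_length_of_surrounds hs
    -- a pair of the circuit which is new: a needle pair, cyclically consecutive on `l`
    have hbad : ∃ x z, s(x, z) ∈ edgesOf (vNdl u v g y) ∧
        ((∃ l₁ l₂, l = l₁ ++ x :: z :: l₂) ∨ (∃ hne : l ≠ [], l.getLast hne = x ∧ l.head hne = z)) := by
      rw [not_and_or] at hall
      rcases hall with hall | hall
      · push Not at hall
        obtain ⟨a, b, l₁, l₂, heq, hab⟩ := hall
        have hab' : s(a, b) ∈ ω' := ((List.isChain_iff_forall_rel_of_append_cons_cons.1 hl.chain) heq).1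
        refine ⟨a, b, ?_, Or.inl ⟨l₁, l₂, heq⟩⟩
        by_contra hE; exact hab (mem_of_mem_vConfig hab' hE)
      · push Not at hall
        obtain ⟨hne, hab⟩ := hall
        refine ⟨l.getLast hne, l.head hne, ?_, Or.inr ⟨hne, rfl, rfl⟩⟩
        by_contra hE; exact hab (mem_of_mem_vConfig (hl.closing hne).1 hE)
    obtain ⟨x, z, hE, hcyc⟩ := hbad
    obtain ⟨a, b, n₁, n₂, hN, hab⟩ := hE
    -- a rotation (possibly of the reversed circuit) starting with the needle pair in needle order
    have hrot : ∃ T, IsOpenCircuit k ω' (slabLift k (annulus D.c D.m D.n)) (a :: b :: T) ∧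
        3 ≤ (a :: b :: T).length := by
      rcases Sym2.eq_iff.1 hab with ⟨hxa, hzb⟩ | ⟨hxb, hza⟩
      · subst hxa hzb
        obtain ⟨T, hT, hlen⟩ := hl.exists_rotate_pair hcyc
        exact ⟨T, hT, by omega⟩
      · -- the pair occurs as `(b, a)` on `l`: use the reversed circuit
        subst hxb hza
        have hcyc' : (∃ l₁ l₂, l.reverse = l₁ ++ z :: x :: l₂) ∨
            (∃ hne : l.reverse ≠ [], l.reverse.getLast hne = z ∧ l.reverse.head hne = x) := by
          rcases hcyc with ⟨l₁, l₂, heq⟩ | ⟨hne, h1, h2⟩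
          · exact Or.inl ⟨l₂.reverse, l₁.reverse, by rw [heq]; simp⟩
          · refine Or.inr ⟨by simpa using hne, ?_, ?_⟩
            · rw [List.getLast_reverse]; exact h2
            · rw [List.head_reverse]; exact h1
        obtain ⟨T, hT, hlen⟩ := hl.reverse.exists_rotate_pair hcyc'
        exact ⟨T, hT, by rw [List.length_reverse] at hlen; omega⟩
    obtain ⟨T, hT, hT3⟩ := hrot
    have hconn := needle_circuit (A := slabLift k (annulus D.c D.m D.n)) hnd (List.cons_ne_nil _ _)
      (vConfig_needle hvy hgy huy) (fun e he hne => mem_of_mem_vConfig he hne)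
      n₁.length n₁ le_rfl a b n₂ T hN hT hT3
    rw [(vNdl_head_last hvy hgy).1, (vNdl_head_last hvy hgy).2] at hconn
    -- an old open path from `u` to `g` inside the world: contradiction
    have : ω ∈ openConnIn (slabLift k D.W) u g :=
      openConnIn_mono (slabLift_mono k D.hAW) _ _ (openConnIn_reverse hconn)
    exact not_joined_u hX hjf hg this

/-- The source is unchanged by the surgery. [cite: NewmanTassionWu2017, §3.2 (CPAM Theorem 3.10: Γ₂ unchanged)] -/
theorem src_vConfig (hvy : planar k v = y) (hgy : planar k g = y) (hg : g ∈ D.Γ ω)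
    (hufar : ¬Near k (D.Γ ω) 0 (planar k u)) : D.src (vConfig ω u v g y) = D.src ω :=
  (src_congr_of_agree (hgy ▸ (planar_mem_of_mem_Γ hg).2.1)
    (fun _ he => vConfig_agree hvy hgy (huy_of hg hgy hufar) he)).symm

/-- **The new configuration joins the source to `g ∈ Γ` by a path meeting `Γ` only at `g`**: the far
path to `u`, the pair `{u, v}`, the vertical segment.
[cite: NewmanTassionWu2017, §3.2 (CPAM Theorem 3.10: ω^{(z)} ∈ {Γ₁ ⟷ Γ₂})] -/
theorem joined_vConfig (hvy : planar k v = y) (hgy : planar k g = y) (hg : g ∈ D.Γ ω)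
    (huv : (slabGraph 3 k).Adj u v) (hufar : ¬Near k (D.Γ ω) 0 (planar k u))
    (hinner : ∀ x ∈ vline k y (ht v) (ht g), x ∈ D.Γ ω → x = g)
    {c₀ : slab 3 k} (hfar : ω ∈ openConnIn (slabLift k D.W ∩ {x | ¬Near k (D.Γ ω) 0 (planar k x)}) c₀ u) :
    vConfig ω u v g y ∈ openConnIn (slabLift k D.W ∩ {z | z ∉ D.Γ ω ∨ z = g}) c₀ g := by
  have huy := huy_of hg hgy hufar
  set ω' := vConfig ω u v g y with hω'
  set S' := slabLift k D.W ∩ {z | z ∉ D.Γ ω ∨ z = g} with hS'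
  -- the far path, still open in `ω'`
  have h1 : ω' ∈ openConnIn (slabLift k D.W ∩ {x | ¬Near k (D.Γ ω) 0 (planar k x)}) c₀ u := by
    refine openConnIn_of_subset_on hfar fun a ha b hb hab => mem_vConfig_iff.2 (Or.inl ⟨hab, fun x hx hxI => ?_⟩)
    rcases Sym2.mem_iff.1 hx with rfl | rfl
    · exact (far_props hg hgy ha.2).2 hxI.1
    · exact (far_props hg hgy hb.2).2 hxI.1
  have hsubS : slabLift k D.W ∩ {x | ¬Near k (D.Γ ω) 0 (planar k x)} ⊆ S' := fun x hx =>
    ⟨hx.1, Or.inl (far_props (v := v) hg hgy hx.2).1⟩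
  have h1' : ω' ∈ openConnIn S' c₀ u := openConnIn_mono hsubS _ _ h1
  -- the needle
  have hch : (vNdl u v g y).IsChain (fun a b => s(a, b) ∈ ω' ∧ a ≠ b) :=
    isChain_of_edgesOf_subset (vNdl_chain hvy hgy huv) fun e he => mem_vConfig_iff.2 (Or.inr he)
  have hsub : ∀ x ∈ vNdl u v g y, x ∈ S' := by
    intro x hx
    unfold vNdl at hx
    rcases List.mem_cons.1 hx with rfl | hx
    · have hxm : x ∈ slabLift k D.W ∩ {x | ¬Near k (D.Γ ω) 0 (planar k x)} := hfar.2.1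
      exact ⟨hxm.1, Or.inl (far_props (v := v) hg hgy hxm.2).1⟩
    · refine ⟨?_, ?_⟩
      · rw [mem_slabLift_iff, ((mem_vSeg_iff x).1 hx).1, ← hgy]; exact (planar_mem_of_mem_Γ hg).2.2
      · by_cases hxg : x = g
        · exact Or.inr hxg
        · exact Or.inl (not_mem_Γ_of_inner hinner ⟨hx, hxg⟩)
  have h2 := openConnIn_of_isChain u (vline k y (ht v) (ht g)) hch hsub
  have hlast : (u :: vline k y (ht v) (ht g)).getLast (List.cons_ne_nil _ _) = g := (vNdl_head_last hvy hgy).2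
  rw [hlast] at h2
  exact SlabCriticality.openConnIn_trans h1' h2

end Main

end CircGlue

/-! ## The recovery statistic of the new configuration, and the located vertical gadget -/

namespace CircGlue

section Recover

variable {k : ℕ} {D : CircGlue k} {ω : BondConfig (slab 3 k)} {y : ℤ × ℤ} {u v g : slab 3 k}

/-- **`g` is recovered**: every vertex of the statistic `att(ω^{(z)})` lies over `y`.  An open path of
`ω^{(z)}` from the source to a vertex `x` of `Γ` meeting `Γ` only at `x` either uses old pairs only
(then the source is glued to `Γ` in `ω` — excluded on `𝒳`), or enters the needle, necessarily through
`u, v`, and then follows it to `g` (`needle_forward`), so `x = g`.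
[cite: NewmanTassionWu2017, §3.2 (CPAM Theorem 3.10: "u ∈ κ_z is the only site on Γ₁(ω^{(z)}) = Γ₁(ω) that connects to Γ₂(ω) without using any other edges in Γ₁")] -/
theorem att_vConfig_subset (hX : ω ∈ D.evX) (hvy : planar k v = y) (hgy : planar k g = y)
    (hg : g ∈ D.Γ ω) (hufar : ¬Near k (D.Γ ω) 0 (planar k u))
    (hjf : D.JoinedFar ω u) (hinner : ∀ x ∈ vline k y (ht v) (ht g), x ∈ D.Γ ω → x = g) :
    D.att (vConfig ω u v g y) ⊆ slabLift k ({y} : Set (ℤ × ℤ)) := by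
  have huy := huy_of hg hgy hufar
  have hnd := vNdl_nodup hvy hgy huy
  have hΓ := Γ_vConfig hX hvy hgy hg hufar hjf hinner
  have hsrc := src_vConfig hvy hgy hg hufar
  have hsp := vSeg_spath (k := k) (v := v) (g := g) hvy hgy
  have hSeglast : (vline k y (ht v) (ht g)).getLast hsp.ne_nil = g :=
    Option.some.inj ((List.getLast?_eq_some_getLast hsp.ne_nil).symm.trans hsp.last)
  obtain ⟨N₂, hNdl, hSeg⟩ := vNdl_eq_cons_cons (u := u) hvy hgy
  set ω' := vConfig ω u v g y with hω'
  intro x hx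
  obtain ⟨hxΓ, c₁, hc₁, hpath⟩ := hx
  rw [hΓ] at hxΓ hpath
  rw [hsrc] at hc₁
  rw [mem_slabLift_iff, Set.mem_singleton_iff]
  -- it suffices to show `x = g`
  suffices hxg : x = g by rw [hxg, hgy]
  obtain ⟨L, hL⟩ := exists_isOSAP_of_openConnIn hpath
  have hLhead : L.head hL.ne_nil = c₁ := by simpa using hL.head_mem hL.ne_nil
  have hLlast : L.getLast hL.ne_nil = x := by simpa using hL.last_mem hL.ne_nil
  -- a vertex of `Γ` on `L` is `x`
  have hΓL : ∀ z ∈ L, z ∈ D.Γ ω → z = x := by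
    intro z hz hzΓ
    rcases (hL.subset z hz).2 with h | h
    · exact absurd hzΓ h
    · exact h
  by_cases hallω : ∀ (a b : slab 3 k) (l₁ l₂ : List (slab 3 k)), L = l₁ ++ a :: b :: l₂ → s(a, b) ∈ ω
  · -- old pairs only: the source is glued to `x ∈ Γ` in `ω`
    exfalso
    have hL' : IsOSAP k ω (slabLift k D.W) {c₁} {x} L := by
      refine ⟨hL.nodup, ?_, fun z hz => (hL.subset z hz).1, hL.ne_nil, hL.head_mem, hL.last_mem⟩
      have hc := List.isChain_iff_forall_rel_of_append_cons_cons.1 hL.chain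
      rw [List.isChain_iff_forall_rel_of_append_cons_cons]
      intro a b l₁ l₂ heq
      exact ⟨hallω a b l₁ l₂ heq, (hc heq).2⟩
    have hconn := hL'.openConnIn_of_mem (hLlast ▸ List.getLast_mem hL.ne_nil)
    rw [hLhead] at hconn
    exact not_joined_of_evX hX hc₁ hxΓ hconn
  · push Not at hallω
    obtain ⟨a, b, l₁, l₂, heq, hab⟩ := hallω
    have hab' : s(a, b) ∈ ω' := ((List.isChain_iff_forall_rel_of_append_cons_cons.1 hL.chain) heq).1
    have hE : s(a, b) ∈ edgesOf (vNdl u v g y) := by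
      by_contra h; exact hab (mem_of_mem_vConfig hab' h)
    -- some vertex of `L` lies on the segment
    have hexS : ∃ w ∈ L, w ∈ vline k y (ht v) (ht g) := by
      obtain ⟨a', b', n₁, n₂, hN, he⟩ := hE
      have hb' := mem_vSeg_of_split hvy hgy huy hN
      have ha : a ∈ L := by rw [heq]; simp
      have hb : b ∈ L := by rw [heq]; simp
      rcases Sym2.eq_iff.1 he with ⟨-, rfl⟩ | ⟨rfl, -⟩
      · exact ⟨b, hb, hb'⟩
      · exact ⟨a, ha, hb'⟩
    obtain ⟨P₀, w, T₀, hLeq, hw, hP₀⟩ := exists_first_split (p := (· ∈ vline k y (ht v) (ht g))) L hexS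
    -- `P₀ ≠ []`: the source is off the column
    have hP₀ne : P₀ ≠ [] := by
      rintro rfl
      have : w = c₁ := by rw [← hLhead]; simp [hLeq]
      subst this
      exact not_near_src (D := D) (ω := ω) hc₁ (near_zero_iff.2 ⟨g, hg, by rw [hgy, ((mem_vSeg_iff w).1 hw).1]⟩)
    by_cases hwg : w = g
    · -- `g` lies on `L`
      subst hwg
      exact (hΓL w (by rw [hLeq]; simp) hg).symm
    -- `w` is an inner vertex entered from `pred`; the needle property forces `pred = u`, `w = v`
    set pred := P₀.getLast hP₀ne with hpred
    have hLeq' : L = P₀.dropLast ++ pred :: w :: T₀ := by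
      rw [hLeq]; conv_lhs => rw [← List.dropLast_append_getLast hP₀ne]
      simp [hpred]
    have hpw : s(pred, w) ∈ ω' := ((List.isChain_iff_forall_rel_of_append_cons_cons.1 hL.chain) hLeq').1
    have hpredS : pred ∉ vline k y (ht v) (ht g) := hP₀ pred (List.getLast_mem hP₀ne)
    obtain ⟨s₁, s₂, hSw⟩ := List.append_of_mem hw
    have hs₂ : s₂ ≠ [] := by
      rintro rfl
      apply hwg
      rw [← hSeglast, List.getLast_congr _ (by simp) hSw]; simp
    have hNw : vNdl u v g y = (u :: s₁) ++ w :: s₂ := by unfold vNdl; rw [hSw]; simp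
    have hadj := vConfig_needle (ω := ω) hvy hgy huy w pred (u :: s₁) s₂ hNw (List.cons_ne_nil _ _) hs₂
      (by rw [Sym2.eq_swap]; exact hpw)
    have hpredN : pred ∈ vNdl u v g y := by
      rcases hadj with ⟨l₁, l₂, h⟩ | ⟨l₁, l₂, h⟩ <;> (rw [h]; simp)
    have hpredu : pred = u := by
      unfold vNdl at hpredN
      rcases List.mem_cons.1 hpredN with h | h
      · exact h
      · exact absurd h hpredS
    have hwv : w = v := by
      rcases hadj with ⟨l₁, l₂, h⟩ | ⟨l₁, l₂, h⟩
      · -- `u` would have the predecessor `w` on the needle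
        rw [hpredu] at h
        exact absurd (vNdl_head_last (u := u) hvy hgy).1.symm (ne_head_of_split hnd h)
      · rw [hpredu] at h
        have hNdl' : vNdl u v g y = [] ++ u :: v :: N₂ := by rw [hNdl]; rfl
        exact eq_of_cons_cons_eq_append hnd hNdl' h
    -- follow the needle from `(u, v)`
    rw [hpredu, hwv] at hLeq'
    have hndL : (P₀.dropLast ++ u :: v :: T₀).Nodup := hLeq' ▸ hL.nodup
    have hchL : (P₀.dropLast ++ u :: v :: T₀).IsChain (fun a b => s(a, b) ∈ ω' ∧ a ≠ b) := hLeq' ▸ hL.chain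
    have hN₂ne : N₂ ≠ [] := by
      rintro rfl
      apply hwg
      rw [hwv, ← hSeglast, List.getLast_congr _ (by simp) hSeg]; simp
    have hgN₂ : N₂.getLast hN₂ne = g := by
      rw [← hSeglast, List.getLast_congr _ (by simp) hSeg, List.getLast_cons hN₂ne]
    rcases needle_forward hnd (vConfig_needle hvy hgy huy) N₂ [] (P₀.dropLast) T₀ u v (by rw [hNdl]; rfl)
        hndL hchL with h1 | ⟨h1, h2⟩
    · -- `L` reaches `g`
      obtain ⟨rest, hT₀⟩ := h1
      have hgL : g ∈ L := by
        rw [hLeq', ← hT₀, ← hgN₂]; simp [List.getLast_mem hN₂ne]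
      exact (hΓL g hgL hg).symm
    · -- `L` stops at an inner vertex, which would be `x ∈ Γ`
      exfalso
      obtain ⟨N₃, hN₂eq⟩ := h1
      have hN₃ : N₃ ≠ [] := by rintro rfl; exact h2 (by simpa using hN₂eq)
      have hxmem : x ∈ v :: T₀ := by
        rw [← hLlast, List.getLast_congr _ (by simp) hLeq', List.getLast_append_of_ne_nil _ (List.cons_ne_nil _ _),
          List.getLast_cons (List.cons_ne_nil _ _)]
        exact List.getLast_mem _
      -- every vertex of `v :: T₀` is on the segment and is not `g`
      have hSeg' : vline k y (ht v) (ht g) = (v :: T₀) ++ N₃ := by rw [hSeg, ← hN₂eq]; simp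
      have hxS : x ∈ vline k y (ht v) (ht g) := by rw [hSeg']; exact List.mem_append_left _ hxmem
      have hxg : x ≠ g := by
        intro hxg
        have hgN₃ : g ∈ N₃ := by
          rw [← hSeglast, List.getLast_congr _ (by simp) hSeg', List.getLast_append_of_ne_nil _ hN₃]
          exact List.getLast_mem _
        have hnd' := hsp.nodup
        rw [hSeg', List.nodup_append] at hnd'
        exact hnd'.2.2 x hxmem g hgN₃ hxg
      exact hxg (hinner x hxS hxΓ)

/-- **The located vertical gadget exists at every entry cell** of every lattice configuration of `𝒳`.
[cite: NewmanTassionWu2017, §3.2 (CPAM Theorem 3.10: construction of ω^{(z)} for z ∈ U(ω))] -/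
theorem exists_vGadget (hX : ω ∈ D.evX) {y : ℤ × ℤ} (hy : y ∈ D.Uent ω) : ∃ ω', VGadget D ω ω' y := by
  classical
  obtain ⟨hnear, u, v, hvy, huv, hufar, hjf⟩ := hy
  -- the vertex of `Γ` over `y` nearest to `v`
  obtain ⟨g₀, hg₀, hg₀y⟩ := near_zero_iff.1 hnear
  set col : Finset (slab 3 k) := ((D.Γ ω).filter fun x => planar k x = y).toFinset with hcol
  have hcolne : col.Nonempty := ⟨g₀, by rw [hcol, List.mem_toFinset, List.mem_filter]; exact ⟨hg₀, by simpa using hg₀y⟩⟩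
  obtain ⟨g, hgcol, hgmin⟩ := col.exists_min_image (fun x => (ht x - ht v) + (ht v - ht x)) hcolne
  rw [hcol, List.mem_toFinset, List.mem_filter] at hgcol
  obtain ⟨hg, hgy⟩ := hgcol
  simp only [decide_eq_true_eq] at hgy
  have hinner : ∀ x ∈ vline k y (ht v) (ht g), x ∈ D.Γ ω → x = g := by
    intro x hx hxΓ
    obtain ⟨hxy, h1, h2⟩ := (mem_vSeg_iff x).1 hx
    have hxcol : x ∈ col := by rw [hcol, List.mem_toFinset, List.mem_filter]; exact ⟨hxΓ, by simpa using hxy⟩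
    have hle := hgmin x hxcol
    have hht : ht x = ht g := by
      rcases le_total (ht v) (ht g) with h | h
      · rw [min_eq_left h, max_eq_right h] at *; omega
      · rw [min_eq_right h, max_eq_left h] at *; omega
    exact (slab_ext_iff x g).2 ⟨by rw [hxy, hgy], hht⟩
  have huy := huy_of hg hgy hufar
  obtain ⟨c₀, hc₀, hfar⟩ := id hjf
  have hΓ := Γ_vConfig hX hvy hgy hg hufar hjf hinner
  have hsrc := src_vConfig hvy hgy hg hufar
  have hjoin := joined_vConfig hvy hgy hg huv hufar hinner hfar
  refine ⟨vConfig ω u v g y, ⟨?_, ?_, fun e he => vConfig_agree hvy hgy huy he, hΓ, ?_, ?_⟩⟩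
  · refine ⟨c₀, by rw [hsrc]; exact hc₀, g, by rw [hΓ]; exact hg, openConnIn_mono Set.inter_subset_left _ _ hjoin⟩
  · intro e he
    have huW : planar k u ∈ D.W := by have := hjf.mem.1; rwa [mem_slabLift_iff] at this
    exact vConfig_window hvy hgy huv huW (mem_of_near_zero hnear).2.2 he
  · refine ⟨g, by rw [hΓ]; exact hg, c₀, by rw [hsrc]; exact hc₀, ?_⟩
    rw [hΓ]; exact hjoin
  · exact att_vConfig_subset hX hvy hgy hg hufar hjf hinner

end Recover

end CircGlue

end NTW17

end Literature.Probability.Percolation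

end
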